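import Summits.AtomisticToContinuum.Crystallization.Theorems.DisclinationRationUniformPolytypeStabilityGapPinningSums

/-!
# `UniformPolytypeStability` (stmt-AtomisticToContinuum-15800), line `birth` (v2, cells): stub `stub_gapPinning`, part 4 (cell bounds)

Route `DisclinationRation`, crux `UniformPolytypeStability`, line `birth` (lead prover-line-stmt-AtomisticToContinuum-15800-0).
Soundness of ONE CELL of the certificate of `…GapPinningDefs` (namespace `StubGapPinning`): for a cell
`(g₁, g₂) = (mkGV N e₁, mkGV N e₂)`, `0 < e₁ ≤ η ≤ e₂`, class `c ∈ {0,1}`, `k ∈ {4,5,7,8}`,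

* `slo g₂ c k ≤ SN k N c η ≤ shi N g₁ c k` (fixed-point sandwich + monotonicity), hence
  `X = SN 4 − 8η² SN 5 ∈ [Xlo, Xhi]`, `Y = SN 7 − 14 η² SN 8 ∈ [Ylo, Yhi]`, and the class differences
  `SN k N 0 − SN k N 1` lie in `[dlo, dhi]` at `e₁` and are bounded by `dsup` on the cell;
* the derivative `d/dη FN N c a η = FNd N c a η` (finite sums of `η (Q + η²)^{-k}`);
* per cell: `FNd N 1 a η ≥ slopeVal` (`slopeOK`, `0 < a ≤ a₂`), `|FNd N c a η| ≤ lipCell` and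
  `|FN N 0 a η − FN N 1 a η| ≤ oscCell` (`a₁ ≤ a ≤ a₂`; interval products `imulLo/imulHi`, mean value theorem).

Everything is `[folklore]`; theorem-only file; nothing here closes an item.  `stub_gapPinningAux4` is the registered anchor.
-/

noncomputable section

namespace Summit.AtomisticToContinuum.Crystallization.Theorems.UniformPolytypeStabilityCells

namespace StubGapPinning

open scoped BigOperators
open Set

/-! ## Derivatives of the truncated sums -/

/-- `d/dη (Q + η²)^{-k} = −2kη (Q + η²)^{-(k+1)}` (`Q ≥ 0`, `η > 0`, `k ≥ 1`). [folklore] -/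
theorem hasDerivAt_term {Q : ℝ} (hQ : 0 ≤ Q) {k : ℕ} (hk : 1 ≤ k) {η : ℝ} (hη : 0 < η) :
    HasDerivAt (fun y : ℝ => ((Q + y ^ 2)⁻¹) ^ k) (-(2 * k * η) * ((Q + η ^ 2)⁻¹) ^ (k + 1)) η := by
  have hpos : 0 < Q + η ^ 2 := by positivity
  have h1 : HasDerivAt (fun y : ℝ => Q + y ^ 2) (2 * η) η := by
    simpa using (hasDerivAt_pow 2 η).const_add Q
  have h2 := (h1.fun_inv hpos.ne').fun_pow k
  refine h2.congr_deriv ?_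
  obtain ⟨j, rfl⟩ : ∃ j, k = j + 1 := ⟨k - 1, by omega⟩
  rw [Nat.add_sub_cancel, div_eq_mul_inv, ← inv_pow]
  push_cast
  ring

/-- `d/dη SN k N c η = −2kη SN (k+1) N c η` (`η > 0`, `k ≥ 1`). [folklore] -/
theorem hasDerivAt_SN {k : ℕ} (hk : 1 ≤ k) (N : ℕ) (c : ℤ) {η : ℝ} (hη : 0 < η) :
    HasDerivAt (fun y => SN k N c y) (-(2 * k * η) * SN (k + 1) N c η) η := by
  have h := HasDerivAt.fun_sum (u := box N) (x := η)
    (A := fun p y => (((Qf c p : ℝ) + y ^ 2)⁻¹) ^ k)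
    (A' := fun p => -(2 * k * η) * (((Qf c p : ℝ) + η ^ 2)⁻¹) ^ (k + 1))
    fun p _ => hasDerivAt_term (Qf_nonneg c p) hk hη
  simp only [SN, Finset.mul_sum]
  exact h

/-- `d/dη FN N c a η = FNd N c a η` (`η > 0`). [folklore] -/
theorem hasDerivAt_FN (N : ℕ) (c : ℤ) (a : ℝ) {η : ℝ} (hη : 0 < η) :
    HasDerivAt (fun y => FN N c a y) (FNd N c a η) η := by
  have h4 := hasDerivAt_SN (k := 4) (by norm_num) N c hη
  have h7 := hasDerivAt_SN (k := 7) (by norm_num) N c hη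
  have h := (hasDerivAt_id η).mul ((h4.const_mul ((a⁻¹) ^ 7)).sub (h7.const_mul ((a⁻¹) ^ 13)))
  have hfun : (fun y => FN N c a y) = fun y => id y * ((a⁻¹) ^ 7 * SN 4 N c y - (a⁻¹) ^ 13 * SN 7 N c y) := by
    funext y; rfl
  rw [hfun]
  refine h.congr_deriv ?_
  simp only [FNd, id_eq, Pi.sub_apply]
  push_cast
  ring

/-- `FN` is continuous on `(0, ∞)` and differentiable there (packaged for the mean value theorems). [folklore] -/
theorem FN_hasDerivWithinAt (N : ℕ) (c : ℤ) (a : ℝ) {S : Set ℝ} (hS : ∀ x ∈ S, 0 < x) :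
    ∀ x ∈ S, HasDerivWithinAt (fun y => FN N c a y) (FNd N c a x) S x :=
  fun x hx => (hasDerivAt_FN N c a (hS x hx)).hasDerivWithinAt

/-! ## Field access of the grid records -/

/-- `(mkGV N e).s c k = sumLo k N c e` for `c ∈ {0,1}`, `k ∈ {4,5,7,8}`. [folklore] -/
theorem mkGV_s {c : ℤ} (hc : c = 0 ∨ c = 1) {k : ℕ} (hk : k = 4 ∨ k = 5 ∨ k = 7 ∨ k = 8) (N : ℕ) (e : ℚ) :
    (mkGV N e).s c k = sumLo k N c e := by
  rcases hc with rfl | rfl <;> rcases hk with rfl | rfl | rfl | rfl <;> rfl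

/-- `(mkGV N e).e = e`. [folklore] -/
theorem mkGV_e (N : ℕ) (e : ℚ) : (mkGV N e).e = e := rfl

/-- `sumLo ≥ 0`. [folklore] -/
theorem sumLo_nonneg (k N : ℕ) (c : ℤ) (e : ℚ) : 0 ≤ sumLo k N c e := by
  refine Finset.sum_nonneg fun p _ => Int.floor_nonneg.2 (mul_nonneg (by norm_num [Mfp]) (pow_nonneg ?_ _))
  exact inv_nonneg.2 (by have := Qf_nonneg c p; exact_mod_cast add_nonneg this (sq_nonneg (e : ℝ)))

/-! ## Enclosures on a cell -/

section cell

variable {N : ℕ} {e₁ e₂ : ℚ} {η : ℝ}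

/-- Lower enclosure: `slo (mkGV N e₂) c k ≤ SN k N c η` for `0 < η ≤ e₂`. [folklore] -/
theorem slo_le {c : ℤ} (hc : c = 0 ∨ c = 1) {k : ℕ} (hk : k = 4 ∨ k = 5 ∨ k = 7 ∨ k = 8)
    (hη : 0 < η) (h₂ : η ≤ e₂) : ((slo (mkGV N e₂) c k : ℚ) : ℝ) ≤ SN k N c η := by
  rw [slo, mkGV_s hc hk]
  push_cast
  rw [div_le_iff₀ (by norm_num [Mfp]), mul_comm]
  exact (sumLo_le k N c e₂).trans (mul_le_mul_of_nonneg_left (SN_anti k N c hη h₂) (by norm_num [Mfp]))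

/-- Upper enclosure: `SN k N c η ≤ shi N (mkGV N e₁) c k` for `0 < e₁ ≤ η`. [folklore] -/
theorem le_shi {c : ℤ} (hc : c = 0 ∨ c = 1) {k : ℕ} (hk : k = 4 ∨ k = 5 ∨ k = 7 ∨ k = 8)
    (he : 0 < e₁) (h₁ : (e₁ : ℝ) ≤ η) : SN k N c η ≤ ((shi N (mkGV N e₁) c k : ℚ) : ℝ) := by
  rw [shi, mkGV_s hc hk, cardB]
  push_cast
  rw [le_div_iff₀ (by norm_num [Mfp]), mul_comm]
  have he' : (0 : ℝ) < e₁ := by exact_mod_cast he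
  refine le_trans (mul_le_mul_of_nonneg_left (SN_anti k N c he' h₁) (by norm_num [Mfp])) ?_
  exact_mod_cast SN_le_sumLo k N c e₁

/-- `slo ≥ 0`. [folklore] -/
theorem slo_nonneg {c : ℤ} (hc : c = 0 ∨ c = 1) {k : ℕ} (hk : k = 4 ∨ k = 5 ∨ k = 7 ∨ k = 8) (e : ℚ) :
    (0 : ℝ) ≤ ((slo (mkGV N e) c k : ℚ) : ℝ) := by
  rw [slo, mkGV_s hc hk]; push_cast
  exact div_nonneg (by exact_mod_cast sumLo_nonneg k N c e) (by norm_num [Mfp])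

variable {c : ℤ} (hc : c = 0 ∨ c = 1) (he : 0 < e₁) (h₁ : (e₁ : ℝ) ≤ η) (h₂ : η ≤ e₂)
include hc he h₁ h₂

/-- `X = SN 4 − 8η² SN 5 ∈ [Xlo, Xhi]` on the cell. [folklore] -/
theorem X_mem : ((Xlo N (mkGV N e₁) (mkGV N e₂) c : ℚ) : ℝ) ≤ SN 4 N c η - 8 * η ^ 2 * SN 5 N c η ∧
    SN 4 N c η - 8 * η ^ 2 * SN 5 N c η ≤ ((Xhi N (mkGV N e₁) (mkGV N e₂) c : ℚ) : ℝ) := by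
  have hη : 0 < η := lt_of_lt_of_le (by exact_mod_cast he) h₁
  have k4 : (4:ℕ) = 4 ∨ 4 = 5 ∨ 4 = 7 ∨ 4 = 8 := by norm_num
  have k5 : (5:ℕ) = 4 ∨ 5 = 5 ∨ 5 = 7 ∨ 5 = 8 := by norm_num
  have hs4 := slo_le (N := N) hc k4 hη h₂
  have hS4 := le_shi (N := N) hc k4 he h₁
  have hs5 := slo_le (N := N) hc k5 hη h₂
  have hS5 := le_shi (N := N) hc k5 he h₁
  have hs5' := slo_nonneg (N := N) hc k5 e₂
  have hsq1 : (e₁ : ℝ) ^ 2 ≤ η ^ 2 := pow_le_pow_left₀ (by exact_mod_cast he.le) h₁ 2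
  have hsq2 : η ^ 2 ≤ (e₂ : ℝ) ^ 2 := pow_le_pow_left₀ hη.le h₂ 2
  have hS50 : 0 ≤ SN 5 N c η := SN_nonneg 5 N c η
  rw [Xlo, Xhi]; push_cast; rw [mkGV_e, mkGV_e]
  constructor
  · nlinarith [mul_le_mul hsq2 hS5 hS50 (sq_nonneg (e₂ : ℝ))]
  · nlinarith [mul_le_mul hsq1 hs5 hs5' (sq_nonneg η)]

/-- `Y = SN 7 − 14η² SN 8 ∈ [Ylo, Yhi]` on the cell. [folklore] -/
theorem Y_mem : ((Ylo N (mkGV N e₁) (mkGV N e₂) c : ℚ) : ℝ) ≤ SN 7 N c η - 14 * η ^ 2 * SN 8 N c η ∧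
    SN 7 N c η - 14 * η ^ 2 * SN 8 N c η ≤ ((Yhi N (mkGV N e₁) (mkGV N e₂) c : ℚ) : ℝ) := by
  have hη : 0 < η := lt_of_lt_of_le (by exact_mod_cast he) h₁
  have k7 : (7:ℕ) = 4 ∨ 7 = 5 ∨ 7 = 7 ∨ 7 = 8 := by norm_num
  have k8 : (8:ℕ) = 4 ∨ 8 = 5 ∨ 8 = 7 ∨ 8 = 8 := by norm_num
  have hs7 := slo_le (N := N) hc k7 hη h₂
  have hS7 := le_shi (N := N) hc k7 he h₁
  have hs8 := slo_le (N := N) hc k8 hη h₂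
  have hS8 := le_shi (N := N) hc k8 he h₁
  have hs8' := slo_nonneg (N := N) hc k8 e₂
  have hsq1 : (e₁ : ℝ) ^ 2 ≤ η ^ 2 := pow_le_pow_left₀ (by exact_mod_cast he.le) h₁ 2
  have hsq2 : η ^ 2 ≤ (e₂ : ℝ) ^ 2 := pow_le_pow_left₀ hη.le h₂ 2
  have hS80 : 0 ≤ SN 8 N c η := SN_nonneg 8 N c η
  rw [Ylo, Yhi]; push_cast; rw [mkGV_e, mkGV_e]
  constructor
  · nlinarith [mul_le_mul hsq2 hS8 hS80 (sq_nonneg (e₂ : ℝ))]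
  · nlinarith [mul_le_mul hsq1 hs8 hs8' (sq_nonneg η)]

end cell

/-! ## Class differences on a cell -/

section diff

variable {N : ℕ} {e₁ e₂ : ℚ} {η : ℝ}

/-- At the left endpoint the class difference `SN k N 0 e₁ − SN k N 1 e₁` lies in `[dlo, dhi]`. [folklore] -/
theorem D_mem_left {k : ℕ} (hk : k = 4 ∨ k = 5 ∨ k = 7 ∨ k = 8) :
    ((dlo N (mkGV N e₁) k : ℚ) : ℝ) ≤ SN k N 0 e₁ - SN k N 1 e₁ ∧
      SN k N 0 e₁ - SN k N 1 e₁ ≤ ((dhi N (mkGV N e₁) k : ℚ) : ℝ) := by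
  have h0 := sumLo_le k N 0 e₁
  have h0' := SN_le_sumLo k N 0 e₁
  have h1 := sumLo_le k N 1 e₁
  have h1' := SN_le_sumLo k N 1 e₁
  rw [dlo, dhi, mkGV_s (Or.inl rfl) hk, mkGV_s (Or.inr rfl) hk, cardB]
  push_cast
  have hM : (0 : ℝ) < Mfp := by norm_num [Mfp]
  constructor
  · rw [div_le_iff₀ hM]; push_cast at h0' h1' ⊢; nlinarith
  · rw [le_div_iff₀ hM]; push_cast at h0' h1' ⊢; nlinarith

/-- On the whole cell `|SN k N 0 η − SN k N 1 η| ≤ dsup`. [folklore] -/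
theorem abs_D_le (he : 0 < e₁) (h₁ : (e₁ : ℝ) ≤ η) (h₂ : η ≤ e₂) {k : ℕ} (hk : k = 4 ∨ k = 5 ∨ k = 7 ∨ k = 8) :
    |SN k N 0 η - SN k N 1 η| ≤ ((dsup N (mkGV N e₁) (mkGV N e₂) k : ℚ) : ℝ) := by
  have hη : 0 < η := lt_of_lt_of_le (by exact_mod_cast he) h₁
  have a0 := slo_le (N := N) (Or.inl rfl) hk hη h₂
  have b0 := le_shi (N := N) (Or.inl rfl) hk he h₁
  have a1 := slo_le (N := N) (Or.inr rfl) hk hη h₂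
  have b1 := le_shi (N := N) (Or.inr rfl) hk he h₁
  rw [dsup]; push_cast
  exact abs_le_max_abs_abs (by linarith) (by linarith)

end diff

/-! ## Interval products -/

/-- `x ∈ [alo, ahi]` with `alo ≥ 0` and `y ∈ [blo, bhi]` ⇒ `x·y ∈ [imulLo, imulHi]`. [folklore] -/
theorem imul_mem {alo ahi blo bhi : ℚ} {x y : ℝ} (halo : 0 ≤ (alo : ℝ)) (hx1 : (alo : ℝ) ≤ x) (hx2 : x ≤ ahi)
    (hy1 : (blo : ℝ) ≤ y) (hy2 : y ≤ bhi) :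
    ((imulLo alo ahi blo bhi : ℚ) : ℝ) ≤ x * y ∧ x * y ≤ ((imulHi alo ahi blo bhi : ℚ) : ℝ) := by
  have hx0 : 0 ≤ x := halo.trans hx1
  rw [imulLo, imulHi]; push_cast
  constructor
  · have h1 : x * (blo : ℝ) ≤ x * y := mul_le_mul_of_nonneg_left hy1 hx0
    refine le_trans ?_ h1
    rcases le_or_gt 0 (blo : ℝ) with hb | hb
    · exact (min_le_left _ _).trans ((min_le_left _ _).trans (mul_le_mul_of_nonneg_right hx1 hb))
    · exact (min_le_right _ _).trans ((min_le_left _ _).trans (by nlinarith))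
  · have h1 : x * y ≤ x * (bhi : ℝ) := mul_le_mul_of_nonneg_left hy2 hx0
    refine h1.trans ?_
    rcases le_or_gt 0 (bhi : ℝ) with hb | hb
    · exact le_trans (mul_le_mul_of_nonneg_right hx2 hb) ((le_max_right _ _).trans (le_max_right _ _))
    · exact le_trans (by nlinarith) ((le_max_right _ _).trans (le_max_left _ _))

/-- Powers of `a⁻¹` on an `a`-cell: `ia₂ ≤ a⁻¹ ≤ ia₁` ⇒ `ia₂ⁿ ≤ a⁻ⁿ ≤ ia₁ⁿ`. [folklore] -/
theorem inv_pow_mem {a : ℝ} {ia₁ ia₂ : ℚ} (hia₂ : 0 ≤ (ia₂ : ℝ)) (h₂ : (ia₂ : ℝ) ≤ a⁻¹) (h₁ : a⁻¹ ≤ ia₁) (n : ℕ) :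
    ((ia₂ ^ n : ℚ) : ℝ) ≤ (a⁻¹) ^ n ∧ (a⁻¹) ^ n ≤ ((ia₁ ^ n : ℚ) : ℝ) := by
  push_cast
  exact ⟨pow_le_pow_left₀ hia₂ h₂ n, pow_le_pow_left₀ (hia₂.trans h₂) h₁ n⟩

/-! ## The three per-cell bounds -/

section percell

variable {N : ℕ} {e₁ e₂ : ℚ} {η a : ℝ} (he : 0 < e₁) (h₁ : (e₁ : ℝ) ≤ η) (h₂ : η ≤ e₂)
include he h₁ h₂

/-- **Slope cell**: `slopeOK ia₂ N g` and `0 < a ≤ a₂ = ia₂⁻¹` ⇒ `FNd N 1 a η ≥ slopeVal ia₂ N g` on the cell. [folklore] -/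
theorem slopeVal_le_FNd {ia₂ : ℚ} (hia₂ : 0 < (ia₂ : ℝ)) (ha₂ : (ia₂ : ℝ) ≤ a⁻¹)
    (hok : slopeOK ia₂ N (mkGV N e₁, mkGV N e₂) = true) :
    ((slopeVal ia₂ N (mkGV N e₁, mkGV N e₂) : ℚ) : ℝ) ≤ FNd N 1 a η := by
  simp only [slopeOK, decide_eq_true_eq] at hok
  obtain ⟨hY, hB⟩ := hok
  have hY' : ((Yhi N (mkGV N e₁) (mkGV N e₂) 1 : ℚ) : ℝ) ≤ 0 := by exact_mod_cast hY
  have hB' : (0 : ℝ) ≤ ((ia₂ ^ 6 * -Yhi N (mkGV N e₁) (mkGV N e₂) 1 + Xlo N (mkGV N e₁) (mkGV N e₂) 1 : ℚ) : ℝ) := by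
    exact_mod_cast hB
  obtain ⟨hXlo, -⟩ := X_mem (N := N) (Or.inr rfl) he h₁ h₂ (c := 1)
  obtain ⟨-, hYhi⟩ := Y_mem (N := N) (Or.inr rfl) he h₁ h₂ (c := 1)
  have h6lo : (ia₂ : ℝ) ^ 6 ≤ (a⁻¹) ^ 6 := pow_le_pow_left₀ hia₂.le ha₂ 6
  have h7lo : (ia₂ : ℝ) ^ 7 ≤ (a⁻¹) ^ 7 := pow_le_pow_left₀ hia₂.le ha₂ 7
  set X := SN 4 N 1 η - 8 * η ^ 2 * SN 5 N 1 η
  set Y := SN 7 N 1 η - 14 * η ^ 2 * SN 8 N 1 η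
  have hFNd : FNd N 1 a η = (a⁻¹) ^ 7 * (X + (a⁻¹) ^ 6 * -Y) := by simp only [FNd, X, Y]; ring
  rw [hFNd, slopeVal]
  push_cast at hB' ⊢
  have hnegY : 0 ≤ -Y := by linarith
  have hstep1 : (ia₂ : ℝ) ^ 6 * -((Yhi N (mkGV N e₁) (mkGV N e₂) 1 : ℚ) : ℝ) ≤ (a⁻¹) ^ 6 * -Y := by
    calc (ia₂ : ℝ) ^ 6 * -((Yhi N (mkGV N e₁) (mkGV N e₂) 1 : ℚ) : ℝ) ≤ (ia₂ : ℝ) ^ 6 * -Y :=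
          mul_le_mul_of_nonneg_left (by linarith) (by positivity)
      _ ≤ (a⁻¹) ^ 6 * -Y := mul_le_mul_of_nonneg_right h6lo hnegY
  have hB0 : (ia₂ : ℝ) ^ 6 * -((Yhi N (mkGV N e₁) (mkGV N e₂) 1 : ℚ) : ℝ) +
      ((Xlo N (mkGV N e₁) (mkGV N e₂) 1 : ℚ) : ℝ) ≤ X + (a⁻¹) ^ 6 * -Y := by linarith
  calc (ia₂ : ℝ) ^ 7 * ((ia₂ : ℝ) ^ 6 * -((Yhi N (mkGV N e₁) (mkGV N e₂) 1 : ℚ) : ℝ) +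
        ((Xlo N (mkGV N e₁) (mkGV N e₂) 1 : ℚ) : ℝ))
      ≤ (ia₂ : ℝ) ^ 7 * (X + (a⁻¹) ^ 6 * -Y) := mul_le_mul_of_nonneg_left hB0 (by positivity)
    _ ≤ (a⁻¹) ^ 7 * (X + (a⁻¹) ^ 6 * -Y) := mul_le_mul_of_nonneg_right h7lo (hB'.trans hB0)

variable (ha : 0 < a) {ia₁ ia₂ : ℚ} (hia₂ : 0 < (ia₂ : ℝ)) (ha₂ : (ia₂ : ℝ) ≤ a⁻¹) (ha₁ : a⁻¹ ≤ ia₁)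
include ha hia₂ ha₂ ha₁

/-- **Lipschitz cell**: `|FNd N c a η| ≤ lipCell ia₁ ia₂ N g c` on the cell for `a ∈ [a₁, a₂]`. [folklore] -/
theorem abs_FNd_le_lipCell {c : ℤ} (hc : c = 0 ∨ c = 1) :
    |FNd N c a η| ≤ ((lipCell ia₁ ia₂ N (mkGV N e₁, mkGV N e₂) c : ℚ) : ℝ) := by
  obtain ⟨hXlo, hXhi⟩ := X_mem (N := N) hc he h₁ h₂ (c := c)
  obtain ⟨hYlo, hYhi⟩ := Y_mem (N := N) hc he h₁ h₂ (c := c)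
  obtain ⟨h6lo, h6hi⟩ := inv_pow_mem hia₂.le ha₂ ha₁ 6
  have hia₁ : (0 : ℝ) ≤ ia₁ := hia₂.le.trans (ha₂.trans ha₁)
  have h7hi : (a⁻¹) ^ 7 ≤ (ia₁ : ℝ) ^ 7 := pow_le_pow_left₀ (hia₂.le.trans ha₂) ha₁ 7
  set X := SN 4 N c η - 8 * η ^ 2 * SN 5 N c η
  set Y := SN 7 N c η - 14 * η ^ 2 * SN 8 N c η
  obtain ⟨hplo, hphi⟩ := imul_mem (x := (a⁻¹) ^ 6) (y := Y) (by push_cast; positivity) h6lo h6hi hYlo hYhi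
  have hFNd : FNd N c a η = (a⁻¹) ^ 7 * (X - (a⁻¹) ^ 6 * Y) := by simp only [FNd, X, Y]; ring
  rw [hFNd, abs_mul, abs_of_nonneg (by positivity : (0 : ℝ) ≤ (a⁻¹) ^ 7), lipCell]
  push_cast
  exact mul_le_mul h7hi (abs_le_max_abs_abs (by linarith) (by linarith)) (abs_nonneg _) (pow_nonneg hia₁ 7)

/-- **Oscillation cell**: `|FN N 0 a η − FN N 1 a η| ≤ oscCell ia₁ ia₂ N g` on the cell for `a ∈ [a₁, a₂]`
(value at `e₁` plus derivative bound times width, by the mean value theorem). [folklore] -/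
theorem abs_FN_sub_le_oscCell :
    |FN N 0 a η - FN N 1 a η| ≤ ((oscCell ia₁ ia₂ N (mkGV N e₁, mkGV N e₂) : ℚ) : ℝ) := by
  have he' : (0 : ℝ) < e₁ := by exact_mod_cast he
  obtain ⟨h6lo, h6hi⟩ := inv_pow_mem hia₂.le ha₂ ha₁ 6
  have hia₁ : (0 : ℝ) ≤ ia₁ := hia₂.le.trans (ha₂.trans ha₁)
  have h7hi : (a⁻¹) ^ 7 ≤ (ia₁ : ℝ) ^ 7 := pow_le_pow_left₀ (hia₂.le.trans ha₂) ha₁ 7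
  have h13hi : (a⁻¹) ^ 13 ≤ (ia₁ : ℝ) ^ 13 := pow_le_pow_left₀ (hia₂.le.trans ha₂) ha₁ 13
  set Φ : ℝ → ℝ := fun y => FN N 0 a y - FN N 1 a y with hΦ
  -- value at the left endpoint
  have hpt : |Φ e₁| ≤ (e₁ : ℝ) * (ia₁ : ℝ) ^ 7 *
      max |((dlo N (mkGV N e₁) 4 : ℚ) : ℝ) - ((imulHi (ia₂ ^ 6) (ia₁ ^ 6) (dlo N (mkGV N e₁) 7) (dhi N (mkGV N e₁) 7) : ℚ) : ℝ)|
        |((dhi N (mkGV N e₁) 4 : ℚ) : ℝ) - ((imulLo (ia₂ ^ 6) (ia₁ ^ 6) (dlo N (mkGV N e₁) 7) (dhi N (mkGV N e₁) 7) : ℚ) : ℝ)| := by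
    obtain ⟨d4lo, d4hi⟩ := D_mem_left (N := N) (e₁ := e₁) (k := 4) (by norm_num)
    obtain ⟨d7lo, d7hi⟩ := D_mem_left (N := N) (e₁ := e₁) (k := 7) (by norm_num)
    obtain ⟨hplo, hphi⟩ := imul_mem (x := (a⁻¹) ^ 6) (y := SN 7 N 0 e₁ - SN 7 N 1 e₁)
      (by push_cast; positivity) h6lo h6hi d7lo d7hi
    have hval : Φ e₁ = (e₁ : ℝ) * (a⁻¹) ^ 7 * ((SN 4 N 0 e₁ - SN 4 N 1 e₁) - (a⁻¹) ^ 6 * (SN 7 N 0 e₁ - SN 7 N 1 e₁)) := by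
      simp only [hΦ, FN]; ring
    rw [hval, abs_mul, abs_mul, abs_of_pos he', abs_of_nonneg (by positivity : (0 : ℝ) ≤ (a⁻¹) ^ 7)]
    exact mul_le_mul (mul_le_mul_of_nonneg_left h7hi he'.le) (abs_le_max_abs_abs (by linarith) (by linarith))
      (abs_nonneg _) (mul_nonneg he'.le (pow_nonneg hia₁ 7))
  -- derivative bound on the cell
  set der : ℝ := (ia₁ : ℝ) ^ 7 * (((dsup N (mkGV N e₁) (mkGV N e₂) 4 : ℚ) : ℝ) + 8 * (e₂ : ℝ) ^ 2 * ((dsup N (mkGV N e₁) (mkGV N e₂) 5 : ℚ) : ℝ)) +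
    (ia₁ : ℝ) ^ 13 * (((dsup N (mkGV N e₁) (mkGV N e₂) 7 : ℚ) : ℝ) + 14 * (e₂ : ℝ) ^ 2 * ((dsup N (mkGV N e₁) (mkGV N e₂) 8 : ℚ) : ℝ)) with hder
  have hderiv : ∀ x ∈ Icc (e₁ : ℝ) e₂, HasDerivWithinAt Φ (FNd N 0 a x - FNd N 1 a x) (Icc (e₁ : ℝ) e₂) x := by
    intro x hx
    have hx0 : 0 < x := lt_of_lt_of_le he' hx.1
    exact ((hasDerivAt_FN N 0 a hx0).sub (hasDerivAt_FN N 1 a hx0)).hasDerivWithinAt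
  have hbound : ∀ x ∈ Icc (e₁ : ℝ) e₂, ‖FNd N 0 a x - FNd N 1 a x‖ ≤ der := by
    intro x hx
    have hx0 : 0 < x := lt_of_lt_of_le he' hx.1
    have d4 := abs_D_le (N := N) he hx.1 hx.2 (k := 4) (by norm_num)
    have d5 := abs_D_le (N := N) he hx.1 hx.2 (k := 5) (by norm_num)
    have d7 := abs_D_le (N := N) he hx.1 hx.2 (k := 7) (by norm_num)
    have d8 := abs_D_le (N := N) he hx.1 hx.2 (k := 8) (by norm_num)
    have hsq : x ^ 2 ≤ (e₂ : ℝ) ^ 2 := pow_le_pow_left₀ hx0.le hx.2 2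
    have hexp : FNd N 0 a x - FNd N 1 a x = (a⁻¹) ^ 7 * ((SN 4 N 0 x - SN 4 N 1 x) - 8 * x ^ 2 * (SN 5 N 0 x - SN 5 N 1 x)) -
        (a⁻¹) ^ 13 * ((SN 7 N 0 x - SN 7 N 1 x) - 14 * x ^ 2 * (SN 8 N 0 x - SN 8 N 1 x)) := by
      simp only [FNd]; ring
    rw [Real.norm_eq_abs, hexp]
    refine (abs_sub _ _).trans ?_
    rw [abs_mul, abs_mul, abs_of_nonneg (by positivity : (0:ℝ) ≤ (a⁻¹) ^ 7),
      abs_of_nonneg (by positivity : (0:ℝ) ≤ (a⁻¹) ^ 13)]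
    have e4 : |SN 4 N 0 x - SN 4 N 1 x - 8 * x ^ 2 * (SN 5 N 0 x - SN 5 N 1 x)| ≤
        ((dsup N (mkGV N e₁) (mkGV N e₂) 4 : ℚ) : ℝ) + 8 * (e₂ : ℝ) ^ 2 * ((dsup N (mkGV N e₁) (mkGV N e₂) 5 : ℚ) : ℝ) := by
      refine (abs_sub _ _).trans (add_le_add d4 ?_)
      rw [abs_mul, abs_of_nonneg (by positivity : (0:ℝ) ≤ 8 * x ^ 2)]
      exact mul_le_mul (by nlinarith) d5 (abs_nonneg _) (by positivity)
    have e7 : |SN 7 N 0 x - SN 7 N 1 x - 14 * x ^ 2 * (SN 8 N 0 x - SN 8 N 1 x)| ≤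
        ((dsup N (mkGV N e₁) (mkGV N e₂) 7 : ℚ) : ℝ) + 14 * (e₂ : ℝ) ^ 2 * ((dsup N (mkGV N e₁) (mkGV N e₂) 8 : ℚ) : ℝ) := by
      refine (abs_sub _ _).trans (add_le_add d7 ?_)
      rw [abs_mul, abs_of_nonneg (by positivity : (0:ℝ) ≤ 14 * x ^ 2)]
      exact mul_le_mul (by nlinarith) d8 (abs_nonneg _) (by positivity)
    rw [hder]
    exact add_le_add (mul_le_mul h7hi e4 (abs_nonneg _) (pow_nonneg hia₁ 7))
      (mul_le_mul h13hi e7 (abs_nonneg _) (pow_nonneg hia₁ 13))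
  have hmvt := Convex.norm_image_sub_le_of_norm_hasDerivWithin_le hderiv hbound (convex_Icc _ _)
    (left_mem_Icc.2 (h₁.trans h₂)) ⟨h₁, h₂⟩
  rw [Real.norm_eq_abs, Real.norm_eq_abs, abs_of_nonneg (sub_nonneg.2 h₁)] at hmvt
  have hder0 : 0 ≤ der := le_trans (norm_nonneg _) (hbound e₁ (left_mem_Icc.2 (h₁.trans h₂)))
  have hfin : |Φ η| ≤ |Φ e₁| + der * ((e₂ : ℝ) - e₁) := by
    have := abs_sub_abs_le_abs_sub (Φ η) (Φ e₁)
    nlinarith [mul_le_mul_of_nonneg_left (sub_le_sub_right h₂ (e₁ : ℝ)) hder0]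
  rw [oscCell]
  push_cast
  simp only [mkGV_e] at *
  exact hfin.trans (add_le_add hpt le_rfl)

end percell

end StubGapPinning

/-- Registered anchor `stub_gapPinningAux4` of the cell-bounds file of `stub_gapPinning`: the truncated layer sum
`SN k N c` has derivative `−2kη SN (k+1) N c` (instance `k = 4`). [folklore] -/
theorem stub_gapPinningAux4 : ∀ (N : ℕ) (c : ℤ) (η : ℝ), 0 < η →
    HasDerivAt (fun y => StubGapPinning.SN 4 N c y) (-(2 * (4 : ℕ) * η) * StubGapPinning.SN (4 + 1) N c η) η :=
  fun N c _ hη => StubGapPinning.hasDerivAt_SN (k := 4) (by norm_num) N c hη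

end Summit.AtomisticToContinuum.Crystallization.Theorems.UniformPolytypeStabilityCells

end
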